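import Summits.Ventures.PercRepro.RankLevelSetCoreSevenOfFormS345
import Summits.Ventures.PercRepro.S2TelescopeCount

/-!
# PercRepro — THE `e`-FREE CORE AT LEVEL `7` FROM A NUMERIC FORM, ON THE TELESCOPING COUNT WITH THE `3`- / `4`- / `5`-CIRCUIT
BOUNDS AS PARAMETERS (p8, gen 20; a feeder for S4 — the top of the `q = 7` window, the rows `64 … 56`)

`c025_core_seven_of_form_tel` — `c025_core_seven_of_form_s345` (RankLevelSetCoreSevenOfFormS345) with the giant-exact
count replaced by THE TELESCOPING COUNT `S2.ncard_eRk_eq_ncard_le_le_tel` (S2TelescopeCount): the `N`-side of the form is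
`nsideTel p d S3 S4 S5` (RankLevelSetTelForm) `= C(n, 7) + Σ_{j < d − 7} Λ(j + 1) + 2^{min 79 (7 + d)}` with the per-level bound
`Λ(0) = C(n, 7)`, `Λ(ν + 1) = min (Π′·C(F, ν)/quart(ν + 1)) (Λ(ν)·(F + 1 − ν)/(ν + 1 + r_min(ν + 1)))`,
`F = min 71 (ν₁ − 2)`, `Π′ = S3·C(n − 3, 5) + S4·C(n − 4, 4) + S5·C(n − 5, 3) + C(d+5, 6)·C(n − 6, 2) + C(d+6, 7)·(n − 7) + C(d+7, 8)`
(THE DISJOINT PAIR COUNT), `r_min` of S2TelescopeLevels; the tail is unchanged. The non-coloop hypothesis of the count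
is discharged by `S2.card_nonColoops_ge_of_flat_bounds` from the flat bounds of the `e`-free core
(`ncard_add_one_le_two_pow_of_eRk_le` at `0, 1, 2`, `ncard_le_six / ten / nineteen / thirtynine_of_…_of_free`).
The assembly of a row supplies the three circuit bounds — the sharp counts of p8 g19. Against the giant-exact count
with the same bounds (the S345 core) the cells `(64, 29 … 33)` go from `1.008 … 1.059` to `≤ 0.27` of the budget, and
every cell `8 ≤ d ≤ 130` of the rows `64 … 56` closes. Axioms: standard.
-/

set_option exponentiation.threshold 1024

open scoped Matroid

namespace PercRepro

namespace ThmN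

open Set

variable {α : Type}

/-- **The `e`-free core at level `7` from a numeric form ON THE TELESCOPING COUNT, the `3`-, `4`- and `5`-circuit bounds
as parameters**: the form `(c₁, c₂)` of the cell `(p, d)` is the `N`-side `c₁·nsideTel p d S3 S4 S5 ≤ c₂·2^{d−7}·C(p+7, 7)`
and the exact `Y`-tail, taken as a HYPOTHESIS; the telescoping count with the nullity cap, `f(7) ≤ 79`, `f(6) ≤ 39`,
the giant flat by its powerset and the non-coloop bound of the `e`-free core (`S2.ncard_eRk_eq_ncard_le_le_tel`,
`S2.card_nonColoops_ge_of_flat_bounds`). -/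
theorem c025_core_seven_of_form_tel (M : Matroid α) [M.Finite] (p d S3 S4 S5 : ℕ) (hd8 : 8 ≤ d)
    (hR : M.eRank = (p : ℕ∞)) (hn : M.E.ncard = p + d)
    (hfree : ∀ e ∈ M.E, ∃ A ⊆ M.E \ {e}, e ∉ M.closure A ∧ e ∉ M.closure ((M.E \ {e}) \ A))
    (hs3 : {C | M.IsCircuit C ∧ C.ncard = 3}.ncard ≤ S3)
    (hs4 : {C | M.IsCircuit C ∧ C.ncard = 4}.ncard ≤ S4)
    (hs5 : {C | M.IsCircuit C ∧ C.ncard = 5}.ncard ≤ S5)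
    (hform :
      ∃ c₁ c₂ : ℕ, 0 < c₂ ∧ c₂ < c₁ ∧
      ((c₁ : ℕ) : ℚ) * nsideTel p d S3 S4 S5 ≤ ((c₂ : ℕ) : ℚ) * 2 ^ (d - 7) * (((p + 7).choose 7 : ℕ) : ℚ) ∧
        c₁ * ((p + d).choose 7 * 2 ^ (min 72 d) + (p + d).choose 6 * 2 ^ 33 + (p + d).choose 5 * 2 ^ 14 + (p + d).choose 4 * 2 ^ 6 + (p + d).choose 3 * 2 ^ 3 + (p + d).choose 2 * 2 + (p + d) + 1 + ∑ j ∈ Finset.range (d + 1), (p + d).choose j) ≤ (c₁ - c₂) * 2 ^ (p + d)) :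
    RLS M p 7 := by
  classical
  have hEcard : M.ground_finite.toFinset.card = p + d := by
    rw [← Set.ncard_eq_toFinset_card _ M.ground_finite]; exact hn
  -- the core is simple: every circuit has `≥ 3` elements
  have hL0 : ∀ e ∈ M.E, ¬ M.IsLoop e := not_isLoop_of_free M hfree
  have hs : ∀ e ∈ M.E, ∀ f ∈ M.E, e ≠ f → M.eRk {e, f} = 2 := by
    intro e he f hf hef
    have h2 : (2 : ℕ∞) ≤ M.eRk {e, f} :=
      two_le_eRk_of_two_le_ncard_of_free M hfree (pair_subset he hf) (by rw [ncard_pair hef])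
    have h3 : M.eRk {e, f} ≤ 2 := by
      have := M.eRk_le_encard {e, f}
      rwa [encard_pair hef] at this
    exact le_antisymm h3 h2
  have hcirc : ∀ C, M.IsCircuit C → 3 ≤ C.encard := three_le_encard_of_circuit M hL0 hs
  have hd : M.E.encard = M.eRank + d := by
    rw [hR, ← M.ground_finite.cast_ncard_eq, hn]
    push_cast
    ring
  -- the nullity cap: every `X ⊆ E` has `|X| ≤ r(X) + d`
  have hcap : ∀ X ⊆ M.E, ∀ k : ℕ, M.eRk X ≤ k → X.ncard ≤ k + d := by
    intro X hX k hr
    have h1 := Matroid.encard_le_eRk_add_of_encard_eq hX hd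
    have h2 : X.encard ≤ (k : ℕ∞) + d := h1.trans (by gcongr)
    have hfin : X.Finite := M.ground_finite.subset hX
    rw [← hfin.cast_ncard_eq] at h2
    exact_mod_cast h2
  -- rank-`≤ 7` sets have `≤ min 79 (7 + d)` points, rank-`≤ 6` sets `≤ min 39 (6 + d)`
  have hflat : ∀ X ⊆ M.E, M.eRk X ≤ 7 → X.ncard ≤ min 79 (7 + d) :=
    fun X hX hr => le_min (ncard_le_seventynine_of_eRk_le_seven_of_free M hfree X hX hr) (hcap X hX 7 hr)
  have hflat' : ∀ X ⊆ M.E, M.eRk X ≤ ((7 - 1 : ℕ) : ℕ∞) → X.ncard ≤ min 39 (6 + d) :=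
    fun X hX hr => le_min (ncard_le_thirtynine_of_eRk_le_six_of_free M hfree hX (by simpa using hr))
      (hcap X hX 6 (by simpa using hr))
  have hinter := hinter_seven M hd hfree
  -- the flat bounds of the `e`-free core at every rank `≤ 6`
  have hC1 : ∀ L ⊆ M.E, M.eRk L = 2 → L.ncard ≤ 3 :=
    fun L hL hr => ncard_le_three_of_eRk_two M hs hfree hL hr
  have hC2 : ∀ P ⊆ M.E, M.eRk P ≤ 3 → P.ncard ≤ 6 :=
    fun P hP hr => ncard_le_six_of_eRk_le_three_of_free M hfree hP hr
  have hf0 : ∀ X ⊆ M.E, M.eRk X ≤ 0 → X.ncard ≤ 0 := fun X hX hr => by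
    have := ncard_add_one_le_two_pow_of_eRk_le M hL0 hfree 0 X hX (by exact_mod_cast hr)
    omega
  have hf1 : ∀ X ⊆ M.E, M.eRk X ≤ 1 → X.ncard ≤ 1 := fun X hX hr => by
    have := ncard_add_one_le_two_pow_of_eRk_le M hL0 hfree 1 X hX (by exact_mod_cast hr)
    omega
  have hf2 : ∀ X ⊆ M.E, M.eRk X ≤ 2 → X.ncard ≤ 3 := fun X hX hr => by
    have := ncard_add_one_le_two_pow_of_eRk_le M hL0 hfree 2 X hX (by exact_mod_cast hr)
    omega
  have hf4 : ∀ X ⊆ M.E, M.eRk X ≤ 4 → X.ncard ≤ 10 :=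
    fun X hX hr => ncard_le_ten_of_eRk_le_four_of_free M hfree hX hr
  have hf5 : ∀ X ⊆ M.E, M.eRk X ≤ 5 → X.ncard ≤ 19 :=
    fun X hX hr => ncard_le_nineteen_of_eRk_le_five_of_free M hfree hX hr
  have hf6 : ∀ X ⊆ M.E, M.eRk X ≤ 6 → X.ncard ≤ 39 :=
    fun X hX hr => ncard_le_thirtynine_of_eRk_le_six_of_free M hfree hX hr
  -- the non-coloop bound on every level set
  have hcol : ∀ m, 7 + 1 ≤ m → m ≤ d → ∀ B ∈ Matroid.levelF M 7 m,
      (fun ν => ν + S2.rminF ν) (m - 7) ≤ (S2.nonColoops M 7 B).card := by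
    intro m hm _ B hB
    rw [Matroid.levelF, Finset.mem_filter, Finset.mem_powersetCard] at hB
    obtain ⟨⟨hBsub, hBcard⟩, hBr⟩ := hB
    have hBE : (B : Set α) ⊆ M.E := by
      rw [← Matroid.coe_groundF M]; exact_mod_cast hBsub
    have := S2.card_nonColoops_ge_of_flat_bounds (M := M) B hBE (by exact_mod_cast hBr) (by omega)
      hf0 hf1 hf2 hC2 hf4 hf5 hf6
    rw [hBcard] at this
    exact this
  have hρ : ∀ ν, 1 ≤ (fun ν => ν + S2.rminF ν) (ν + 1) := fun ν => by
    have := S2.one_le_rminF (ν + 1)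
    simp only
    omega
  -- the circuit counts beyond `5`: the nullity bounds
  have hs6 : {C | M.IsCircuit C ∧ C.ncard = 6}.ncard ≤ (d + 5).choose 6 :=
    Matroid.ncard_circuits_le_choose_of_encard M hd 5
  have hs7 : {C | M.IsCircuit C ∧ C.ncard = 7}.ncard ≤ (d + 6).choose 7 :=
    Matroid.ncard_circuits_le_choose_of_encard M hd 6
  have hs8 : {C | M.IsCircuit C ∧ C.ncard = 8}.ncard ≤ (d + 7).choose 8 :=
    Matroid.ncard_circuits_le_choose_of_encard M hd 7
  -- (U): the telescoping count, in `ℚ`, then the circuit bounds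
  have hU0 := S2.ncard_eRk_eq_ncard_le_le_tel M 7 (min 79 (7 + d)) (min 39 (6 + d))
    (max ((d + min 33 d) / 2 + 1) (min 32 (d - 1) + 2)) (min 33 d) (fun ν => ν + S2.rminF ν)
    (by norm_num) hcirc hC1 hC2 hflat hflat' hinter hd (by omega) (by omega) hρ hcol
  have hU1 := Matroid.topCount_le_ncard_compl (M := M) hR hd 7
  have hm1 : min (min 79 (7 + d) - (7 + 1)) (max ((d + min 33 d) / 2 + 1) (min 32 (d - 1) + 2) - 2) =
      min 71 (max ((d + min 33 d) / 2 + 1) (min 32 (d - 1) + 2) - 2) := by omega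
  have hm3 : min (min 79 (7 + d)) (7 + d) = min 79 (7 + d) := by omega
  rw [hn, sum_Icc_three_eight_q, hm1, hm3] at hU0
  simp only [show (7 : ℕ) + 1 = 8 from rfl, show (8 : ℕ) - 3 = 5 from rfl, show (8 : ℕ) - 4 = 4 from rfl,
    show (8 : ℕ) - 5 = 3 from rfl, show (8 : ℕ) - 6 = 2 from rfl, show (8 : ℕ) - 7 = 1 from rfl,
    show (8 : ℕ) - 8 = 0 from rfl, Nat.choose_one_right, Nat.choose_zero_right] at hU0
  have hUq : (Matroid.topCount M p 7 : ℚ) ≤ nsideTel p d S3 S4 S5 := by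
    have hU1q : (Matroid.topCount M p 7 : ℚ) ≤
        ({B : Set α | B ⊆ M.E ∧ M.eRk B = 7 ∧ B.ncard ≤ d}.ncard : ℚ) := by exact_mod_cast hU1
    have hsm : {C | M.IsCircuit C ∧ C.ncard = 3}.ncard * (p + d - 3).choose 5 +
        {C | M.IsCircuit C ∧ C.ncard = 4}.ncard * (p + d - 4).choose 4 +
        {C | M.IsCircuit C ∧ C.ncard = 5}.ncard * (p + d - 5).choose 3 +
        {C | M.IsCircuit C ∧ C.ncard = 6}.ncard * (p + d - 6).choose 2 +
        {C | M.IsCircuit C ∧ C.ncard = 7}.ncard * (p + d - 7) + {C | M.IsCircuit C ∧ C.ncard = 8}.ncard * 1 ≤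
        S3 * (p + d - 3).choose 5 + S4 * (p + d - 4).choose 4 +
          S5 * (p + d - 5).choose 3 + (d + 5).choose 6 * (p + d - 6).choose 2 +
          (d + 6).choose 7 * (p + d - 7) + (d + 7).choose 8 := by
      have := hs8
      gcongr
      omega
    have hsmq : (({C | M.IsCircuit C ∧ C.ncard = 3}.ncard : ℚ) * ((p + d - 3).choose 5 : ℚ) +
        ({C | M.IsCircuit C ∧ C.ncard = 4}.ncard : ℚ) * ((p + d - 4).choose 4 : ℚ) +
        ({C | M.IsCircuit C ∧ C.ncard = 5}.ncard : ℚ) * ((p + d - 5).choose 3 : ℚ) +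
        ({C | M.IsCircuit C ∧ C.ncard = 6}.ncard : ℚ) * ((p + d - 6).choose 2 : ℚ) +
        ({C | M.IsCircuit C ∧ C.ncard = 7}.ncard : ℚ) * ((p + d - 7 : ℕ) : ℚ) +
        ({C | M.IsCircuit C ∧ C.ncard = 8}.ncard : ℚ) * ((1 : ℕ) : ℚ)) ≤
        ((S3 * (p + d - 3).choose 5 + S4 * (p + d - 4).choose 4 +
          S5 * (p + d - 5).choose 3 + (d + 5).choose 6 * (p + d - 6).choose 2 +
          (d + 6).choose 7 * (p + d - 7) + (d + 7).choose 8 : ℕ) : ℚ) := by exact_mod_cast hsm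
    refine hU1q.trans (hU0.trans ?_)
    unfold nsideTel
    refine add_le_add (add_le_add le_rfl (Finset.sum_le_sum (fun j _ => ?_))) le_rfl
    apply S2.lamTel_mono
    push_cast at hsmq ⊢
    linarith
  -- (Y): the rank-`≤ 7` sets through their closures; the spanning sets by the `5/2` tail
  have hY := Matroid.two_pow_le_midCount_add (M := M) p 7 hR
  have hsum7 := S2.ncard_eRk_le_le_sum M 7
  simp only [Finset.sum_range_succ, Finset.sum_range_zero, zero_add] at hsum7
  have hB := Matroid.ncard_spanning_le (M := M) hd
  rw [hEcard] at hY hB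
  obtain ⟨c₁, c₂, hc₂, hc₁₂, hpolyq, hT⟩ := hform
  have hAB : c₁ * ({X : Set α | X ⊆ M.E ∧ M.eRk X ≤ 7}.ncard +
      {X : Set α | X ⊆ M.E ∧ M.eRk X = M.eRank}.ncard) ≤ (c₁ - c₂) * 2 ^ (p + d) := by
    have h7 : {X : Set α | X ⊆ M.E ∧ M.eRk X = (7 : ℕ)}.ncard ≤ M.E.ncard.choose 7 * 2 ^ (min 72 d) := by
      have := S2.ncard_eRk_eq_le_choose_mul_two_pow M 7 (min 79 (7 + d))
        (fun X hX hr => hflat X hX (by exact_mod_cast hr))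
      rwa [show min 79 (7 + d) - 7 = min 72 d by omega] at this
    have h6 : {X : Set α | X ⊆ M.E ∧ M.eRk X = (6 : ℕ)}.ncard ≤ M.E.ncard.choose 6 * 2 ^ (39 - 6) :=
      S2.ncard_eRk_eq_le_choose_mul_two_pow M 6 39
        (fun X hX hr => ncard_le_thirtynine_of_eRk_le_six_of_free M hfree hX (by exact_mod_cast hr))
    have h5 : {X : Set α | X ⊆ M.E ∧ M.eRk X = (5 : ℕ)}.ncard ≤ M.E.ncard.choose 5 * 2 ^ (19 - 5) :=
      S2.ncard_eRk_eq_le_choose_mul_two_pow M 5 19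
        (fun X hX hr => ncard_le_nineteen_of_eRk_le_five_of_free M hfree hX (by exact_mod_cast hr))
    have h4 : {X : Set α | X ⊆ M.E ∧ M.eRk X = (4 : ℕ)}.ncard ≤ M.E.ncard.choose 4 * 2 ^ (10 - 4) :=
      S2.ncard_eRk_eq_le_choose_mul_two_pow M 4 10
        (fun X hX hr => ncard_le_ten_of_eRk_le_four_of_free M hfree hX (by exact_mod_cast hr))
    have h3 : {X : Set α | X ⊆ M.E ∧ M.eRk X = (3 : ℕ)}.ncard ≤ M.E.ncard.choose 3 * 2 ^ (6 - 3) :=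
      S2.ncard_eRk_eq_le_choose_mul_two_pow M 3 6
        (fun X hX hr => ncard_le_six_of_eRk_le_three_of_free M hfree hX (by exact_mod_cast hr))
    have h2 : {X : Set α | X ⊆ M.E ∧ M.eRk X = (2 : ℕ)}.ncard ≤ M.E.ncard.choose 2 * 2 ^ (3 - 2) :=
      S2.ncard_eRk_eq_le_choose_mul_two_pow M 2 3
        (fun X hX hr => by
          have := ncard_add_one_le_two_pow_of_eRk_le M hL0 hfree 2 X hX hr
          omega)
    have h1 : {X : Set α | X ⊆ M.E ∧ M.eRk X = (1 : ℕ)}.ncard ≤ M.E.ncard.choose 1 * 2 ^ (1 - 1) :=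
      S2.ncard_eRk_eq_le_choose_mul_two_pow M 1 1
        (fun X hX hr => by
          have := ncard_add_one_le_two_pow_of_eRk_le M hL0 hfree 1 X hX hr
          omega)
    have h0 : {X : Set α | X ⊆ M.E ∧ M.eRk X = (0 : ℕ)}.ncard ≤ M.E.ncard.choose 0 * 2 ^ (0 - 0) :=
      S2.ncard_eRk_eq_le_choose_mul_two_pow M 0 0
        (fun X hX hr => by
          have := ncard_add_one_le_two_pow_of_eRk_le M hL0 hfree 0 X hX hr
          omega)
    simp only [Nat.choose_one_right, Nat.choose_zero_right, Nat.sub_self, pow_zero, mul_one] at h1 h0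
    rw [hn] at h7 h6 h5 h4 h3 h2 h1
    push_cast at hsum7 h7 h6 h5 h4 h3 h2 h1 h0
    have hA : {X : Set α | X ⊆ M.E ∧ M.eRk X ≤ 7}.ncard ≤
        (p + d).choose 7 * 2 ^ (min 72 d) + (p + d).choose 6 * 2 ^ 33 + (p + d).choose 5 * 2 ^ 14 +
          (p + d).choose 4 * 2 ^ 6 + (p + d).choose 3 * 2 ^ 3 + (p + d).choose 2 * 2 + (p + d) + 1 := by
      omega
    have hG : {X : Set α | X ⊆ M.E ∧ M.eRk X ≤ 7}.ncard + {X : Set α | X ⊆ M.E ∧ M.eRk X = M.eRank}.ncard ≤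
        (p + d).choose 7 * 2 ^ (min 72 d) + (p + d).choose 6 * 2 ^ 33 + (p + d).choose 5 * 2 ^ 14 +
          (p + d).choose 4 * 2 ^ 6 + (p + d).choose 3 * 2 ^ 3 + (p + d).choose 2 * 2 + (p + d) + 1 +
          ∑ j ∈ Finset.range (d + 1), (p + d).choose j := by
      omega
    exact le_trans (Nat.mul_le_mul_left _ hG) hT
  -- (Φ) and the polynomial inequality
  have hΦ := phiK_le_two_pow_div p 7
  rw [Nat.choose_symm_add] at hΦ
  -- assemble in `ℚ`
  rw [RLS_iff]
  have hYq : (2 : ℚ) ^ (p + d) ≤ (Matroid.midCount M p 7 : ℚ) +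
      ({X : Set α | X ⊆ M.E ∧ M.eRk X ≤ 7}.ncard : ℚ) +
      ({X : Set α | X ⊆ M.E ∧ M.eRk X = M.eRank}.ncard : ℚ) := by exact_mod_cast hY
  have hABq : (c₁ : ℚ) * (({X : Set α | X ⊆ M.E ∧ M.eRk X ≤ 7}.ncard : ℚ) +
      ({X : Set α | X ⊆ M.E ∧ M.eRk X = M.eRank}.ncard : ℚ)) ≤
      ((c₁ - c₂ : ℕ) : ℚ) * 2 ^ (p + d) := by exact_mod_cast hAB
  have hU0' : (0 : ℚ) ≤ (Matroid.topCount M p 7 : ℚ) := Nat.cast_nonneg _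
  have hd7 : 7 ≤ d := by omega
  have hUq' : (Matroid.topCount M p 7 : ℚ) ≤ (((p + d).choose 7 : ℕ) : ℚ) +
      (nsideTel p d S3 S4 S5 - (((p + d).choose 7 : ℕ) : ℚ)) := by linarith
  have hpolyq' : (c₁ : ℚ) * ((((p + d).choose 7 : ℕ) : ℚ) + (nsideTel p d S3 S4 S5 - (((p + d).choose 7 : ℕ) : ℚ))) ≤
      (c₂ : ℚ) * 2 ^ (d - 7) * (((p + 7).choose 7 : ℕ) : ℚ) := by
    have : (((p + d).choose 7 : ℕ) : ℚ) + (nsideTel p d S3 S4 S5 - (((p + d).choose 7 : ℕ) : ℚ)) =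
        nsideTel p d S3 S4 S5 := by ring
    rw [this]; exact hpolyq
  exact level_arith_form (p := p) (d := d) (n := p + d) (q := 7) rfl hd7 hc₂ hc₁₂ hΦ hU0' hUq' hYq hABq hpolyq'

end ThmN

end PercRepro
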